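import Summits.Ventures.CertifiedArithmetic.LowPrec.SRPythagorasNestedFormats
import Summits.Ventures.CertifiedArithmetic.LowPrec.SRPythagorasJumpLever
import HarnessLib

/-!
# Stochastic rounding in low-precision formats CVII — StochasticA with FEWER bits than binades: the
# `N`-binade locality condition `JumpLE`, drift-antitonicity and the Pythagorean MSE law for every `n`

HONEST FRAMING: certified error envelopes and provably optimal rounding/accumulation schemes for
low-precision formats under stated cost models; every table by two implementations; no hardware or
vendor claims.

XCIV (`SRPythagorasNested`) proved the Pythagorean law `E(ŝₙ − sₙ)² ≤ n·G²/4 + (n·2^{-N}·G)²` for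
IEEE P3109 StochasticA (`N` random bits, `SR_{p,r}` of [ElararEtAl2025]) on every one-signed nested
window under the GLOBAL bit threshold `N ≥ J` (`J + 1` binades met), and XCV showed the threshold is
attained: with `N = J − 1` bits a two-summand tree that jumps from the finest to the coarsest binade in
ONE step is not drift-antitone.  This file replaces the global threshold by a LOCAL, decidable tree
condition that holds for every `N`, however many binades the window spans:

* `JumpLE F hi N x n s` (the `N`-binade locality condition): from every state `v` the tree produces
  (both candidates of every branch point, exact landings included; the deterministic start `s` is
  exempt), no later rounding on the subtree from `v` happens in a cell wider than `2^N·σ₊(v)`, where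
  `σ₊(v)` is the grid spacing just above `v` — in a binary format: no later rounding more than `N`
  binades above any earlier reached state.  Finitely checkable (`jumpLEB_iff`); automatic when `N ≥ J`
  (`NestedWindow.jumpLE_of_le`, so XCIV is the special case); and violated by XCV's sharpness witnesses
  exactly at their super-jump (`Formats.superjump_witnesses_not_jumpLE`).
* THE LEVER it rests on is CVI (`SRPythagorasJumpLever`): the one-step mean of StochasticA is monotone
  and `1`-Lipschitz along window points `c ≤ c'` as soon as `c' − c ∈ (2^i·g)ℤ` and
  `width(c) ≤ 2^N·2^i·g` (the sub-quantum of the LOWER cell divides the shift), carried by the COARSE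
  GRID and SUCCESSOR CELL structure of nested windows (`NestedWindow.coarse`, `succ_spacing`).
* CONTRACTION (`NestedWindow.accExpQA_contract_of_jumpLE`): for grid points `t ≤ t'` whose difference is
  a multiple of `2^i·g` with `GapLE (2^N·2^i·g)` on the tree from `t` and `JumpLE` on both trees,
  `E[ŝₙ | t'] − E[ŝₙ | t] ≤ t' − t` (induction over the tree; the three sub-pairs `(⌊c̄⌋, ⌈c̄⌉)`,
  `(⌈c̄⌉, ⌊c̄'⌋)`, `(⌊c̄'⌋, ⌈c̄'⌉)` get their moduli from the cell width, the successor cell and the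
  cell width respectively — only the LOWER tree's modulus is ever needed); hence
  `driftAntitone_stochasticA_of_jumpLE` and, by XCII's `accExpQ_sq_le_of_driftAntitone`, the law
  `stochasticA_acc_sq_le_of_jumpLE` with `G = 2^J·g`, `ε = 2^{-N}`, for EVERY `n` and EVERY `N`.
* Only UPWARD jumps are constrained: roundings below an earlier state, exact landings and slowly
  growing branches cost nothing, so DESCENDING accumulations satisfy `JumpLE` for every `N` however
  many binades they traverse.  Kernel instances on E3M2 (`Formats`): a DESCENDING six-summand
  accumulation from `28` rounding in all FIVE binades of `[1, 28]` with TWO random bits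
  (`e3m2_descending_twoBits`, XCIV asks for `4` bits, CIV's one-bit theorem does not apply), an
  increasing five-summand accumulation rounding in FOUR binades with TWO bits
  (`e3m2_fourBinade_twoBits`, XCIV: `3` bits) and a four-summand accumulation rounding in THREE binades
  with ONE bit (`e3m2_threeBinade_oneBit`: drift-antitone, which CI denies in general for one bit across
  two boundaries; its law at `N = 1` is also CIV's) satisfy `JumpLE`, hence are drift-antitone and obey
  the law; all six super-jump witnesses of XCV (`N = J − 1`, E3M2 and FP4) violate `JumpLE`.
Scope (honest): one-signed windows (`0 ≤ lo`), no saturation, fixed summands; `JumpLE` is sufficient,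
not necessary (sr-seat certificate gen19/jump, two implementations: on random non-saturating E3M2 trees
a majority satisfies `JumpLE`, a larger majority is drift-antitone, and NO violation of the law itself
was found with or without `JumpLE` — whether the law holds for ALL StochasticA trees with `2 ≤ N < J`
stays open).
Prior art searched: [ElararEtAl2025, Thm. 3–4] (first-order relative error model of `SR_{p,r}`, no
tree condition), [XiaEtAl2022], [ConnollyHighamMary2021, Lemma 4.4], IEEE P3109; no Mathlib precedent.
-/


namespace Summit.Ventures.CertifiedArithmetic.LowPrec.SR

open Literature.ComputerArithmetic.ConnollyHighamMary2021
open Finset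

variable {K : Type*} [Field K] [LinearOrder K] [IsStrictOrderedRing K] [FloorRing K]

namespace LimitedBits

/-! ### The `N`-binade locality condition `JumpLE` -/

/-- `JumpLE F hi N x n s` — the `N`-BINADE LOCALITY CONDITION of a StochasticA tree: for every state
`v` produced by the tree (both candidates `⌊c̄⌋_F, ⌈c̄⌉_F` of every branch point `c = ŝₖ + xₖ`, exact
landings included; the start `s` itself is exempt) and every `a ∈ F` with `v < a ≤ hi`, every cell met
by the subtree from `v` has width `≤ 2^N·(a − v)` — equivalently (the successor of `v` is the binding
`a`) no later rounding is coarser than `2^N` times the grid spacing just above `v`. -/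
def JumpLE (F : Finset K) (hi : K) (N : ℕ) : (ℕ → K) → ℕ → K → Prop
  | _, 0, _ => True
  | x, n + 1, s =>
      (∀ a ∈ F, dn F (s + x 0) < a → a ≤ hi →
          GapLE F (2 ^ N * (a - dn F (s + x 0))) (fun i => x (i + 1)) n (dn F (s + x 0)))
      ∧ (∀ a ∈ F, up F (s + x 0) < a → a ≤ hi →
          GapLE F (2 ^ N * (a - up F (s + x 0))) (fun i => x (i + 1)) n (up F (s + x 0)))
      ∧ JumpLE F hi N (fun i => x (i + 1)) n (up F (s + x 0))
      ∧ JumpLE F hi N (fun i => x (i + 1)) n (dn F (s + x 0))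

/-- Boolean evaluator of `JumpLE` (clean kernel reduction for `decide` certificates). -/
def jumpLEB (F : Finset K) (hi : K) (N : ℕ) : (ℕ → K) → ℕ → K → Bool
  | _, 0, _ => true
  | x, n + 1, s =>
      decide (∀ a ∈ F, dn F (s + x 0) < a → a ≤ hi →
          gapLEB F (2 ^ N * (a - dn F (s + x 0))) (fun i => x (i + 1)) n (dn F (s + x 0)) = true)
      && decide (∀ a ∈ F, up F (s + x 0) < a → a ≤ hi →
          gapLEB F (2 ^ N * (a - up F (s + x 0))) (fun i => x (i + 1)) n (up F (s + x 0)) = true)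
      && jumpLEB F hi N (fun i => x (i + 1)) n (up F (s + x 0))
      && jumpLEB F hi N (fun i => x (i + 1)) n (dn F (s + x 0))

omit [IsStrictOrderedRing K] [FloorRing K] in
/-- `jumpLEB` computes `JumpLE`. -/
theorem jumpLEB_iff (F : Finset K) (hi : K) (N : ℕ) (x : ℕ → K) (n : ℕ) (s : K) :
    jumpLEB F hi N x n s = true ↔ JumpLE F hi N x n s := by
  induction n generalizing x s with
  | zero => simp [jumpLEB, JumpLE]
  | succ n ih => simp [jumpLEB, JumpLE, ih, gapLEB_iff, Bool.and_eq_true, and_assoc]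

omit [IsStrictOrderedRing K] [FloorRing K] in
/-- `JumpLE` is decidable (via `jumpLEB`). -/
instance instDecidableJumpLE (F : Finset K) (hi : K) (N : ℕ) (x : ℕ → K) (n : ℕ) (s : K) :
    Decidable (JumpLE F hi N x n s) :=
  decidable_of_iff _ (jumpLEB_iff F hi N x n s)

namespace NestedWindow

variable {F : Finset K} {lo hi g : K} {J : ℕ}

/-! ### Contraction, drift-antitonicity and the law under `JumpLE` -/

/-- **Contraction of the mean map under `JumpLE`.**  On a one-signed nested window, for window grid
points `t ≤ t'` with `t' − t ∈ (2^i·g)ℤ`, `GapLE (2^N·2^i·g)` on the tree from `t` and `JumpLE` on both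
(unsaturated, in-window) trees: `E[ŝₙ | t'] − E[ŝₙ | t] ≤ t' − t`, for every `N`. -/
theorem accExpQA_contract_of_jumpLE (hW : NestedWindow F lo hi g J) (hlo : 0 ≤ lo) (N : ℕ) :
    ∀ (x : ℕ → K) (n : ℕ) (t t' : K), t ∈ F → t' ∈ F → lo ≤ t → t' ≤ hi → t ≤ t' →
      NoSat F x n t → InWindow F lo hi x n t → NoSat F x n t' → InWindow F lo hi x n t' →
      JumpLE F hi N x n t → JumpLE F hi N x n t' →
      ∀ i : ℕ, GapLE F (2 ^ N * (2 ^ i * g)) x n t → (∃ z : ℤ, t' - t = z * (2 ^ i * g)) →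
      accExpQ F (probAwayA N) x n (fun y => y) t'
        - accExpQ F (probAwayA N) x n (fun y => y) t ≤ t' - t := by
  intro x n
  induction n generalizing x with
  | zero => intros; simp [accExpQ]
  | succ n ih =>
    rintro t t' ht ht' hlt hth htt ⟨hin, hnu, hnd⟩ ⟨⟨h1, h2⟩, hwu, hwd⟩ ⟨hin', hnu', hnd'⟩
      ⟨⟨h1', h2'⟩, hwu', hwd'⟩ ⟨hJd, hJu, hJJu, hJJd⟩ ⟨hJd', -, hJJu', hJJd'⟩ i ⟨hwc, -, -⟩ ⟨z, hz⟩
    rw [clamp_eq_self hin] at h1 h2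
    rw [clamp_eq_self hin'] at h1' h2'
    have hg := hW.pos
    have hcc : t + x 0 ≤ t' + x 0 := by linarith
    have hk : (t' + x 0) - (t + x 0) = z * (2 ^ i * g) := by rw [← hz]; ring
    have hwc' : up F (t + x 0) - dn F (t + x 0) ≤ 2 ^ N * (2 ^ i * g) := hwc
    obtain ⟨hτ1, hτ2⟩ := hW.stepQA_lever_of_jump hlo h1 hcc h2' hwc' hk
    simp only [stepQ] at hτ1 hτ2
    obtain ⟨hdF, huF, hlod, huhi, hdc, hcu⟩ := hW.cand h1 h2
    obtain ⟨hdF', huF', hlod', huhi', hdc', hcu'⟩ := hW.cand h1' h2'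
    obtain ⟨hp0, hp1⟩ := pUpQ_mem F (probAwayA_mem N) (t + x 0)
    obtain ⟨hp0', hp1'⟩ := pUpQ_mem F (probAwayA_mem N) (t' + x 0)
    set q := probAwayA (K := K) N
    set x' : ℕ → K := fun i => x (i + 1)
    -- the adjacent pair of a cell: modulus = the cell width (clause of `JumpLE` at the lower endpoint)
    have hcell : ∀ c : K, lo ≤ c → c ≤ hi → NoSat F x' n (up F c) → InWindow F lo hi x' n (up F c) →
        NoSat F x' n (dn F c) → InWindow F lo hi x' n (dn F c) →
        JumpLE F hi N x' n (up F c) → JumpLE F hi N x' n (dn F c) →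
        (∀ a ∈ F, dn F c < a → a ≤ hi → GapLE F (2 ^ N * (a - dn F c)) x' n (dn F c)) →
        accExpQ F q x' n (fun y => y) (up F c) - accExpQ F q x' n (fun y => y) (dn F c)
          ≤ up F c - dn F c := by
      intro c hc1 hc2 cnu cwu cnd cwd cJu cJd cl
      obtain ⟨cdF, cuF, clod, cuhi, cdc, ccu⟩ := hW.cand hc1 hc2
      by_cases hdeg : up F c = dn F c
      · rw [hdeg]; simp
      · obtain ⟨j, -, hwj⟩ := hW.width c hc1 hc2 hdeg
        have hdu : dn F c < up F c := lt_of_le_of_ne (dn_le_up F c) (Ne.symm hdeg)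
        have hG := cl (up F c) cuF hdu cuhi
        rw [hwj] at hG
        exact ih x' (dn F c) (up F c) cdF cuF clod cuhi hdu.le cnd cwd cnu cwu cJd cJu j hG
          ⟨1, by rw [hwj]; ring⟩
    have IH1 := hcell (t + x 0) h1 h2 hnu hwu hnd hwd hJJu hJJd hJd
    have IH2 := hcell (t' + x 0) h1' h2' hnu' hwu' hnd' hwd' hJJu' hJJd' hJd'
    show stepQ F q (t' + x 0) (accExpQ F q x' n fun y => y)
        - stepQ F q (t + x 0) (accExpQ F q x' n fun y => y) ≤ t' - t
    simp only [stepQ]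
    by_cases hsep : up F (t + x 0) ≤ dn F (t' + x 0)
    · -- different cells: the middle pair `(⌈c̄⌉, ⌊c̄'⌋)` gets its modulus from the successor cell
      have IH3 : accExpQ F q x' n (fun y => y) (dn F (t' + x 0))
          - accExpQ F q x' n (fun y => y) (up F (t + x 0)) ≤ dn F (t' + x 0) - up F (t + x 0) := by
        rcases eq_or_lt_of_le hsep with heq | hlt'
        · rw [heq]; simp
        · obtain ⟨i₁, z₁, -, haF, hva, hah, hwi, hz₁⟩ :=
            hW.succ_spacing huF (h1.trans hcu) hdF' hlt' (hdc'.trans h2')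
          have hG := hJu _ haF hva hah
          rw [hwi] at hG
          exact ih x' (up F (t + x 0)) (dn F (t' + x 0)) huF hdF' (h1.trans hcu) (hdc'.trans h2')
            hsep hnu hwu hnd' hwd' hJJu hJJd' i₁ hG ⟨z₁, hz₁⟩
      set p := pUpQ F q (t + x 0)
      set p' := pUpQ F q (t' + x 0)
      have e1 := mul_le_mul_of_nonneg_left IH2 hp0'
      have e2 := mul_le_mul_of_nonneg_left IH1 (sub_nonneg.mpr hp1)
      linarith [e1, e2, IH3, hτ2]
    · obtain ⟨hdd, huu⟩ := hW.cell_eq h1 hcc h2' (not_le.mp hsep)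
      rw [hdd, huu] at hτ1 hτ2 ⊢
      set p := pUpQ F q (t + x 0)
      set p' := pUpQ F q (t' + x 0)
      rcases eq_or_lt_of_le (hdc.trans hcu) with hdu | hdu
      · rw [hdu]; linarith [htt]
      · have hpp : 0 ≤ p' - p :=
          (mul_nonneg_iff_of_pos_right (sub_pos.mpr hdu)).mp (by linarith [hτ1])
        have e1 := mul_le_mul_of_nonneg_left IH1 hpp
        linarith [e1, hτ2]

/-- **StochasticA trees satisfying `JumpLE` are drift-antitone** (one-signed nested window, no
saturation, every `N`). -/
theorem driftAntitone_stochasticA_of_jumpLE (hW : NestedWindow F lo hi g J) (hlo : 0 ≤ lo) (N : ℕ) :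
    ∀ (x : ℕ → K) (n : ℕ) (s : K), NoSat F x n s → InWindow F lo hi x n s → JumpLE F hi N x n s →
      DriftAntitone F (probAwayA N) x n s := by
  intro x n
  induction n generalizing x with
  | zero => intro s _ _ _; trivial
  | succ n ih =>
    rintro s ⟨hin, hnu, hnd⟩ ⟨⟨h1, h2⟩, hwu, hwd⟩ ⟨hJd, -, hJJu, hJJd⟩
    refine ⟨?_, ih _ _ hnu hwu hJJu, ih _ _ hnd hwd hJJd⟩
    rw [clamp_eq_self hin] at h1 h2
    obtain ⟨hdF, huF, hlod, huhi, hdc, hcu⟩ := hW.cand h1 h2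
    by_cases hdeg : up F (s + x 0) = dn F (s + x 0)
    · rw [hdeg]
    · obtain ⟨j, -, hwj⟩ := hW.width (s + x 0) h1 h2 hdeg
      have hdu : dn F (s + x 0) < up F (s + x 0) := lt_of_le_of_ne (dn_le_up F _) (Ne.symm hdeg)
      have hG := hJd (up F (s + x 0)) huF hdu huhi
      rw [hwj] at hG
      have := hW.accExpQA_contract_of_jumpLE hlo N (fun i => x (i + 1)) n (dn F (s + x 0))
        (up F (s + x 0)) hdF huF hlod huhi hdu.le hnd hwd hnu hwu hJJd hJJu j hG ⟨1, by rw [hwj]; ring⟩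
      linarith

/-- **MSE of StochasticA under the `N`-binade locality condition, every `n`, every `N`.**  On a
one-signed nested window, a StochasticA tree with `N` random bits that satisfies `JumpLE` obeys the
Pythagorean law with `G = 2^J·g`, `ε = 2^{-N}`: `E(ŝₙ − sₙ)² ≤ n·G²/4 + (n·2^{-N}·G)²`. -/
theorem stochasticA_acc_sq_le_of_jumpLE (hW : NestedWindow F lo hi g J) (hlo : 0 ≤ lo) (N : ℕ)
    (x : ℕ → K) (n : ℕ) (s : K) (hns : NoSat F x n s) (hw : InWindow F lo hi x n s)
    (hj : JumpLE F hi N x n s) :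
    accExpQ F (probAwayA N) x n (fun t => (t - (s + ∑ i ∈ range n, x i)) ^ 2) s
      ≤ n * ((2 ^ J * g) ^ 2 / 4) + (n * (1 / 2 ^ N * (2 ^ J * g))) ^ 2 :=
  accExpQ_sq_le_of_driftAntitone F (probAwayA_mem N) (fun η _ _ => abs_probAwayA_sub_le N η) x n s hns
    (hW.gapLE x n s hw) (hW.driftAntitone_stochasticA_of_jumpLE hlo N x n s hns hw hj)

/-- **`N ≥ J` random bits imply `JumpLE`** (grid points are `≥ g` apart and no cell is wider than
`2^J·g`): XCIV's `stochasticA_acc_sq_le` is the special case of `stochasticA_acc_sq_le_of_jumpLE`. -/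
theorem jumpLE_of_le (hW : NestedWindow F lo hi g J) {N : ℕ} (hJN : J ≤ N) :
    ∀ (x : ℕ → K) (n : ℕ) (s : K), NoSat F x n s → InWindow F lo hi x n s → JumpLE F hi N x n s := by
  intro x n
  induction n generalizing x with
  | zero => intro s _ _; trivial
  | succ n ih =>
    rintro s ⟨hin, hnu, hnd⟩ ⟨⟨h1, h2⟩, hwu, hwd⟩
    rw [clamp_eq_self hin] at h1 h2
    have hg := hW.pos
    obtain ⟨hdF, huF, hlod, huhi, hdc, hcu⟩ := hW.cand h1 h2
    have key : ∀ v : K, v ∈ F → lo ≤ v → InWindow F lo hi (fun i => x (i + 1)) n v →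
        ∀ a ∈ F, v < a → a ≤ hi → GapLE F (2 ^ N * (a - v)) (fun i => x (i + 1)) n v := by
      intro v hv hlv hwv a ha hva hah
      have hsep := hW.add_le_of_lt hv ha hlv hva hah
      refine gapLE_mono F ?_ _ _ _ (hW.gapLE _ _ _ hwv)
      calc (2 : K) ^ J * g ≤ 2 ^ N * g :=
            mul_le_mul_of_nonneg_right (pow_le_pow_right₀ (by norm_num) hJN) hg.le
        _ ≤ 2 ^ N * (a - v) := mul_le_mul_of_nonneg_left (by linarith) (by positivity)
    exact ⟨key _ hdF hlod hwd, key _ huF (h1.trans hcu) hwu, ih _ _ hnu hwu, ih _ _ hnd hwd⟩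

end NestedWindow

end LimitedBits

/-! ### Kernel instances on E3M2 and FP4 -/

namespace Formats

open LimitedBits
open Literature.ComputerArithmetic.FloatingPoint (Format)

/-- The E3M2 window `[2, 28]` (spacings `1/2, 1, 2, 4`) is nested with `g = 1/2`, `J = 3` (from XCV's
`valueSet_nestedWindow`, binade indices `3` and `6`). -/
theorem e3m2_nested_2_28 : NestedWindow e3m2 2 28 (1 / 2) 3 := by
  have h := valueSet_nestedWindow Format.E3M2 (lo := 2) (hi := 28)
    (by rw [← e3m2_eq_valueSet]; decide +kernel) (by rw [← e3m2_eq_valueSet]; decide +kernel) (by norm_num)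
  have h1 : binadeIdx Format.E3M2 2 = 3 := by decide +kernel
  have h2 : binadeIdx Format.E3M2 28 = 6 := by decide +kernel
  have hq : Format.E3M2.quantum = 1 / 16 := by decide +kernel
  rw [h1, h2, hq, ← e3m2_eq_valueSet] at h
  norm_num at h
  exact h

/-- The E3M2 window `[1, 28]` (spacings `1/4, …, 4`) is nested with `g = 1/4`, `J = 4`. -/
theorem e3m2_nested_1_28 : NestedWindow e3m2 1 28 (1 / 4) 4 := by
  have h := valueSet_nestedWindow Format.E3M2 (lo := 1) (hi := 28)
    (by rw [← e3m2_eq_valueSet]; decide +kernel) (by rw [← e3m2_eq_valueSet]; decide +kernel) (by norm_num)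
  have h1 : binadeIdx Format.E3M2 1 = 2 := by decide +kernel
  have h2 : binadeIdx Format.E3M2 28 = 6 := by decide +kernel
  have hq : Format.E3M2.quantum = 1 / 16 := by decide +kernel
  rw [h1, h2, hq, ← e3m2_eq_valueSet] at h
  norm_num at h
  exact h

/-- **Two bits down five binades** (kernel instance of the theorem).  The DESCENDING E3M2
accumulation `ŝ₀ = 28`, summands `−57/8, −51/8, −7/2, −15/4, −15/8, −5/8` rounds in every one of the
five binades `[16,28], [8,16), [4,8), [2,4), [1,2)` of the window `[1, 28]` (`J = 4`, `G = 4`; 17 leaves);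
no later rounding lies above an earlier state by more than two binades, so `JumpLE` holds with `N = 2`:
StochasticA with TWO random bits is drift-antitone on it and `E(ŝ₆ − s₆)² ≤ 6·G²/4 + (6·2^{-2}·G)²`
(`= 60`; the exact value is `5723/2048`), where XCIV's threshold asks for FOUR bits. -/
theorem e3m2_descending_twoBits :
    NoSat e3m2 (seqL [-57 / 8, -51 / 8, -7 / 2, -15 / 4, -15 / 8, -5 / 8]) 6 28 ∧
    InWindow e3m2 1 28 (seqL [-57 / 8, -51 / 8, -7 / 2, -15 / 4, -15 / 8, -5 / 8]) 6 28 ∧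
    JumpLE e3m2 28 2 (seqL [-57 / 8, -51 / 8, -7 / 2, -15 / 4, -15 / 8, -5 / 8]) 6 28 ∧
    DriftAntitone e3m2 (probAwayA 2) (seqL [-57 / 8, -51 / 8, -7 / 2, -15 / 4, -15 / 8, -5 / 8]) 6 28 ∧
    accExpQ e3m2 (probAwayA 2) (seqL [-57 / 8, -51 / 8, -7 / 2, -15 / 4, -15 / 8, -5 / 8]) 6
        (fun t => (t - (28 + ∑ i ∈ range 6, seqL [-57 / 8, -51 / 8, -7 / 2, -15 / 4, -15 / 8, -5 / 8] i)) ^ 2)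
        28
      ≤ 6 * ((4 : ℚ) ^ 2 / 4) + (6 * ((1 : ℚ) / 2 ^ 2 * 4)) ^ 2 := by
  have hns : NoSat e3m2 (seqL [-57 / 8, -51 / 8, -7 / 2, -15 / 4, -15 / 8, -5 / 8]) 6 28 := by
    rw [← noSatB_iff]; decide +kernel
  have hw : InWindow e3m2 1 28 (seqL [-57 / 8, -51 / 8, -7 / 2, -15 / 4, -15 / 8, -5 / 8]) 6 28 := by
    rw [← inWindowB_iff]; decide +kernel
  have hj : JumpLE e3m2 28 2 (seqL [-57 / 8, -51 / 8, -7 / 2, -15 / 4, -15 / 8, -5 / 8]) 6 28 := by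
    rw [← jumpLEB_iff]; decide +kernel
  refine ⟨hns, hw, hj, e3m2_nested_1_28.driftAntitone_stochasticA_of_jumpLE (by norm_num) 2 _ 6 28 hns hw hj,
    (e3m2_nested_1_28.stochasticA_acc_sq_le_of_jumpLE (by norm_num) 2 _ 6 28 hns hw hj).trans
      (le_of_eq (by norm_num))⟩

/-- The E3M2 window `[1, 7]` (spacings `1/4, 1/2, 1`) is nested with `g = 1/4`, `J = 2`. -/
theorem e3m2_nested_1_7 : NestedWindow e3m2 1 7 (1 / 4) 2 := by
  have h := valueSet_nestedWindow Format.E3M2 (lo := 1) (hi := 7)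
    (by rw [← e3m2_eq_valueSet]; decide +kernel) (by rw [← e3m2_eq_valueSet]; decide +kernel) (by norm_num)
  have h1 : binadeIdx Format.E3M2 1 = 2 := by decide +kernel
  have h2 : binadeIdx Format.E3M2 7 = 4 := by decide +kernel
  have hq : Format.E3M2.quantum = 1 / 16 := by decide +kernel
  rw [h1, h2, hq, ← e3m2_eq_valueSet] at h
  norm_num at h
  exact h

/-- **Two bits across four binades** (kernel instance of the theorem).  The increasing E3M2
accumulation `ŝ₀ = 2`, summands `7/4, 37/16, 3/2, 11/4, 11/4` (every summand below the running sum;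
roundings in the four binades `[2,4), [4,8), [8,16), [16,28]`, so every window containing the tree has
`J ≥ 3`) satisfies the `2`-binade locality condition; hence StochasticA with TWO random bits is
drift-antitone on it and obeys the law `E(ŝ₅ − s₅)² ≤ 5·G²/4 + (5·2^{-2}·G)²`, `G = 4` — where XCIV's
global threshold asks for `N ≥ 3`. -/
theorem e3m2_fourBinade_twoBits :
    NoSat e3m2 (seqL [7 / 4, 37 / 16, 3 / 2, 11 / 4, 11 / 4]) 5 2 ∧
    InWindow e3m2 2 28 (seqL [7 / 4, 37 / 16, 3 / 2, 11 / 4, 11 / 4]) 5 2 ∧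
    JumpLE e3m2 28 2 (seqL [7 / 4, 37 / 16, 3 / 2, 11 / 4, 11 / 4]) 5 2 ∧
    DriftAntitone e3m2 (probAwayA 2) (seqL [7 / 4, 37 / 16, 3 / 2, 11 / 4, 11 / 4]) 5 2 ∧
    accExpQ e3m2 (probAwayA 2) (seqL [7 / 4, 37 / 16, 3 / 2, 11 / 4, 11 / 4]) 5
        (fun t => (t - (2 + ∑ i ∈ range 5, seqL [7 / 4, 37 / 16, 3 / 2, 11 / 4, 11 / 4] i)) ^ 2) 2
      ≤ 5 * ((4 : ℚ) ^ 2 / 4) + (5 * ((1 : ℚ) / 2 ^ 2 * 4)) ^ 2 := by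
  have hns : NoSat e3m2 (seqL [7 / 4, 37 / 16, 3 / 2, 11 / 4, 11 / 4]) 5 2 := by
    rw [← noSatB_iff]; decide +kernel
  have hw : InWindow e3m2 2 28 (seqL [7 / 4, 37 / 16, 3 / 2, 11 / 4, 11 / 4]) 5 2 := by
    rw [← inWindowB_iff]; decide +kernel
  have hj : JumpLE e3m2 28 2 (seqL [7 / 4, 37 / 16, 3 / 2, 11 / 4, 11 / 4]) 5 2 := by
    rw [← jumpLEB_iff]; decide +kernel
  refine ⟨hns, hw, hj, e3m2_nested_2_28.driftAntitone_stochasticA_of_jumpLE (by norm_num) 2 _ 5 2 hns hw hj,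
    (e3m2_nested_2_28.stochasticA_acc_sq_le_of_jumpLE (by norm_num) 2 _ 5 2 hns hw hj).trans
      (le_of_eq (by norm_num))⟩

/-- **One bit across three binades** (kernel instance of the theorem).  The doubling E3M2 accumulation
`ŝ₀ = 1`, summands `7/8, 3/4, 3/2, 2` (each below the running sum; roundings in the three binades
`[1,2), [2,4), [4,8)`) satisfies the `1`-binade locality condition, so StochasticA with ONE random bit
is DRIFT-ANTITONE on it (and obeys `E(ŝ₄ − s₄)² ≤ 4·G²/4 + (4·2^{-1}·G)²`, `G = 1`, which for one bit is
also CIV's threshold-free theorem) — across two binade boundaries, where one bit is NOT drift-antitone in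
general (XCIII `e3m2_threeBinade_A1_not`, XCV, CI). -/
theorem e3m2_threeBinade_oneBit :
    NoSat e3m2 (seqL [7 / 8, 3 / 4, 3 / 2, 2]) 4 1 ∧
    InWindow e3m2 1 7 (seqL [7 / 8, 3 / 4, 3 / 2, 2]) 4 1 ∧
    JumpLE e3m2 7 1 (seqL [7 / 8, 3 / 4, 3 / 2, 2]) 4 1 ∧
    DriftAntitone e3m2 (probAwayA 1) (seqL [7 / 8, 3 / 4, 3 / 2, 2]) 4 1 ∧
    accExpQ e3m2 (probAwayA 1) (seqL [7 / 8, 3 / 4, 3 / 2, 2]) 4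
        (fun t => (t - (1 + ∑ i ∈ range 4, seqL [7 / 8, 3 / 4, 3 / 2, 2] i)) ^ 2) 1
      ≤ 4 * ((1 : ℚ) ^ 2 / 4) + (4 * ((1 : ℚ) / 2 ^ 1 * 1)) ^ 2 := by
  have hns : NoSat e3m2 (seqL [7 / 8, 3 / 4, 3 / 2, 2]) 4 1 := by
    rw [← noSatB_iff]; decide +kernel
  have hw : InWindow e3m2 1 7 (seqL [7 / 8, 3 / 4, 3 / 2, 2]) 4 1 := by
    rw [← inWindowB_iff]; decide +kernel
  have hj : JumpLE e3m2 7 1 (seqL [7 / 8, 3 / 4, 3 / 2, 2]) 4 1 := by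
    rw [← jumpLEB_iff]; decide +kernel
  refine ⟨hns, hw, hj, e3m2_nested_1_7.driftAntitone_stochasticA_of_jumpLE (by norm_num) 1 _ 4 1 hns hw hj,
    (e3m2_nested_1_7.stochasticA_acc_sq_le_of_jumpLE (by norm_num) 1 _ 4 1 hns hw hj).trans
      (le_of_eq (by norm_num))⟩

/-- **XCV's sharpness witnesses violate `JumpLE` exactly at their super-jump** (kernel): with
`N = J − 1` bits each two-summand witness of `e3m2_bits_threshold_sharp` / `e2m1_two_bits_needed`
(not drift-antitone) carries a state of the finest binade into a cell `N + 1` binades higher. -/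
theorem superjump_witnesses_not_jumpLE :
    ¬ JumpLE e3m2 5 0 (seqL [5 / 4, 5 / 2]) 2 1 ∧
    ¬ JumpLE e3m2 5 1 (seqL [-9 / 8, 5 / 2]) 2 3 ∧
    ¬ JumpLE e3m2 10 2 (seqL [1 / 8, 67 / 8]) 2 1 ∧
    ¬ JumpLE e3m2 10 3 (seqL [1 / 16, 135 / 16]) 2 (1 / 2) ∧
    ¬ JumpLE e3m2 10 4 (seqL [1 / 32, 519 / 64]) 2 0 ∧
    ¬ JumpLE FP4.e2m1 6 1 (seqL [1 / 8, 4]) 2 (1 / 2) := by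
  refine ⟨?_, ?_, ?_, ?_, ?_, ?_⟩ <;> (rw [← jumpLEB_iff]; decide +kernel)

end Formats

end Summit.Ventures.CertifiedArithmetic.LowPrec.SR
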